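import Summits.ResolutionOfSingularities.ResolutionOfSingularities.Theorems.WallCutClasses
import HarnessLib

/-!
# WallCutCritical — the CRITICAL SHADE `s = pᵉ` of the located residual `WallCut.NoLossyStrictTailsDeep` is EMPTY
(hypothesis-free, port-free, pure ledger; all `p`, all `e`, all fields)

decomp-res-lens-3, gen 25 («LossIsolation», Lemma C).  On a plateau of shade exactly `q = pᵉ` the boundary mass is
NON-DECREASING: the ledger `|r_{t+1}| + q = |kept_t| + s_t + |r_t|` (tree `BoundaryLedger.ledger_step`) with `s_t = q` reads
`|r_{t+1}| = |kept_t| + |r_t|`.  A proximity repeat `StaysOnNewest W t` (the chart changes at move `t+1` and the centre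
stays on the component created by move `t`) KEEPS that component, whose mass is `o_t − q ≥ 1` as soon as `ordZero F_t ≠ q`;
so every repeat raises `|r|` by at least one, while `|r_t| < 2q` along any forced walk (tree `BoundaryLedger.degree_le_of_walk`,
from isolation).  Hence a critical plateau with `ordZero ≠ q` carries only finitely many proximity repeats:
`critical_plateau_no_recurrent_stays`.  Consequently the residual class `NoLossyStrictTailsDeep` REDUCES to its
sub-critical part `s < pᵉ` (`noLossyStrictTailsDeep_of_subcritical`; the supercritical part `s > pᵉ` is the tree's
`not_eventually_supercritical`).  No statement is re-typed: the reduction's hypothesis is the target's binder list verbatim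
with the single extra binder `s < p ^ e`.
-/

open MvPolynomial Finset
open Literature.AlgebraicGeometry.Resolution
open Literature.AlgebraicGeometry.Resolution.Hauser2010
open Literature.AlgebraicGeometry.Resolution.PointBlowup
open Summit.ResolutionOfSingularities.ResolutionOfSingularities.Theorems.TightDefectClasses
open Summit.ResolutionOfSingularities.ResolutionOfSingularities.Theorems.TightDefectStrongWalks
open Summit.ResolutionOfSingularities.ResolutionOfSingularities.Theorems.ItineraryCutClasses
open Summit.ResolutionOfSingularities.ResolutionOfSingularities.Theorems.BoundaryLedger
open Summit.ResolutionOfSingularities.ResolutionOfSingularities.Theorems.ProximityCut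
open Summit.ResolutionOfSingularities.ResolutionOfSingularities.Theorems.WallCut

namespace Summit.ResolutionOfSingularities.ResolutionOfSingularities.Theorems.WallCutCritical

section Law

variable {p e : ℕ} {K : Type} [Field K] [DecidableEq K] {s₀ : State (Fin 3) K}

/-- A plateau binder `shade(t+1) = shade(t)` for `t ≥ N` makes the shade CONSTANT from `N` on. [folklore] -/
theorem shade_eq_of_plateau (W : ForcedWalk (p ^ e) s₀) {N : ℕ} {c : ℕ∞}
    (hplat : ∀ t, N ≤ t → (W.st (t + 1)).shade = (W.st t).shade) (hN : (W.st N).shade = c) :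
    ∀ t, N ≤ t → (W.st t).shade = c := by
  have key : ∀ k : ℕ, (W.st (N + k)).shade = c := by
    intro k
    induction k with
    | zero => simpa using hN
    | succ k ih =>
      show (W.st (N + k + 1)).shade = c
      rw [hplat (N + k) (Nat.le_add_right N k)]
      exact ih
  intro t ht
  obtain ⟨k, rfl⟩ := Nat.exists_eq_add_of_le ht
  exact key k

/-- **CRITICAL LEDGER (PROVED):** on a stage of shade exactly `q` the boundary mass does not decrease:
`|r_{t+1}| = |kept_t| + |r_t|`. [folklore] -/
theorem degree_r_succ_of_critical (hroot : IsRoot (p ^ e) s₀) (W : ForcedWalk (p ^ e) s₀) (t : ℕ)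
    (hsh : (W.st t).shade = ((p ^ e : ℕ) : ℕ∞)) :
    (W.st (t + 1)).r.degree = (kept W t).degree + (W.st t).r.degree := by
  obtain ⟨s, hs, hled⟩ := ledger_step hroot W t
  have hsq : s = p ^ e := by
    have h := hsh
    rw [hs] at h
    exact_mod_cast h
  omega

/-- **A PROXIMITY REPEAT RAISES THE MASS ON A CRITICAL PLATEAU (PROVED):** if move `t+1` stays on the component created by
move `t` (`StaysOnNewest W t`), the stages `t`, `t+1` have shade `q` and `ordZero F_t ≠ q`, then `|r_{t+2}| ≥ |r_{t+1}| + 1`.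
[folklore] -/
theorem degree_r_gain_of_stays (hroot : IsRoot (p ^ e) s₀) (W : ForcedWalk (p ^ e) s₀) (t : ℕ)
    (hsh : (W.st (t + 1)).shade = ((p ^ e : ℕ) : ℕ∞)) (hne : ordZero (W.st t).F ≠ ((p ^ e : ℕ) : ℕ∞))
    (hst : StaysOnNewest W t) : (W.st (t + 1)).r.degree + 1 ≤ (W.st (t + 2)).r.degree := by
  classical
  obtain ⟨o, ho, hqo⟩ := walk_nat hroot W t
  have hoq : p ^ e + 1 ≤ o := by
    have : o ≠ p ^ e := fun h => hne (by rw [ho, h])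
    omega
  have hr : (W.st (t + 1)).r (W.j t) = o - p ^ e := by
    rw [r_succ_eq W t ho, Finsupp.add_apply, Finsupp.single_eq_same, kept_apply,
      if_neg (fun h => h.1 rfl), zero_add]
  have hk : o - p ^ e ≤ (kept W (t + 1)).degree := by
    have h1 : kept W (t + 1) (W.j t) = (W.st (t + 1)).r (W.j t) := by
      rw [kept_apply, if_pos ⟨Ne.symm hst.1, hst.2⟩]
    calc o - p ^ e = kept W (t + 1) (W.j t) := by rw [h1, hr]
      _ ≤ (kept W (t + 1)).degree := Finsupp.le_degree _ _
  have := degree_r_succ_of_critical hroot W (t + 1) hsh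
  show (W.st (t + 1)).r.degree + 1 ≤ (W.st (t + 1 + 1)).r.degree
  omega

/-- **LEMMA C — NO RECURRENT PROXIMITY REPEATS ON A CRITICAL PLATEAU (PROVED, hypothesis-free):** a forced walk from a root
whose shade is `q = pᵉ` and whose order is `≠ q` from stage `N` on makes only finitely many `StaysOnNewest` moves. [new] -/
theorem critical_plateau_no_recurrent_stays (hroot : IsRoot (p ^ e) s₀) (W : ForcedWalk (p ^ e) s₀) (N : ℕ)
    (hplat : ∀ t, N ≤ t → (W.st t).shade = ((p ^ e : ℕ) : ℕ∞))
    (hne : ∀ t, N ≤ t → ordZero (W.st t).F ≠ ((p ^ e : ℕ) : ℕ∞))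
    (hS : ∀ M : ℕ, ∃ t, M ≤ t ∧ StaysOnNewest W t) : False := by
  classical
  have hmono : ∀ t k : ℕ, N ≤ t → (W.st t).r.degree ≤ (W.st (t + k)).r.degree := by
    intro t k ht
    induction k with
    | zero => simp
    | succ k ih =>
      show (W.st t).r.degree ≤ (W.st (t + k + 1)).r.degree
      have := degree_r_succ_of_critical hroot W (t + k) (hplat (t + k) (by omega))
      omega
  have hgrow : ∀ n : ℕ, ∃ t, N ≤ t ∧ n ≤ (W.st t).r.degree := by
    intro n
    induction n with
    | zero => exact ⟨N, le_rfl, Nat.zero_le _⟩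
    | succ n ih =>
      obtain ⟨t, hNt, hnt⟩ := ih
      obtain ⟨t', htt', hst⟩ := hS t
      refine ⟨t' + 2, by omega, ?_⟩
      have h1 := hmono t (t' + 1 - t) hNt
      rw [show t + (t' + 1 - t) = t' + 1 by omega] at h1
      have h2 := degree_r_gain_of_stays hroot W t' (hplat (t' + 1) (by omega)) (hne t' (by omega)) hst
      omega
  obtain ⟨t, -, ht⟩ := hgrow (2 * p ^ e)
  have := degree_le_of_walk hroot W t
  omega

end Law

/-- **THE LOCATED RESIDUAL REDUCES TO ITS SUB-CRITICAL PART (PROVED, hypothesis-free).**  `WallCut.NoLossyStrictTailsDeep`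
follows from the same statement with the ONE extra binder `s < p ^ e` (inserted after `p ^ e + 2 ≤ 2 * s`): the critical shade
`s = pᵉ` is excluded by `critical_plateau_no_recurrent_stays` (ledger + the proximity-repeat recurrence; LOSSY, JOINT, SMALL,
DEAD unused), the supercritical shades by the tree's `not_eventually_supercritical`. [new] -/
theorem noLossyStrictTailsDeep_of_subcritical
    (h : ∀ p : ℕ, p.Prime → ∀ e : ℕ, 2 ≤ e → ∀ (K : Type) [Field K] [CharP K p] [PerfectField K] [DecidableEq K]
      (s₀ : State (Fin 3) K), IsRoot (p ^ e) s₀ → ∀ W : ForcedWalk (p ^ e) s₀, (∀ i, 1 ≤ (W.st i).shade) →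
      ∀ N : ℕ, (∀ t, N ≤ t → (W.st (t + 1)).shade = (W.st t).shade) →
      (∀ t, N ≤ t → ordZero (W.st t).F ≠ ((p ^ e : ℕ) : ℕ∞)) → (∀ M : ℕ, ∃ t, M ≤ t ∧ StaysOnNewest W t) →
      (∀ M : ℕ, ∃ t, M ≤ t ∧ W.b t ≠ 0) →
      ∀ s : ℕ, (W.st N).shade = (s : ℕ∞) → 3 ≤ s → p ^ e + 3 ≤ 3 * s → p ^ e + 2 ≤ 2 * s → s < p ^ e →
      (∀ (k : Fin 3) (N' : ℕ), ∃ t, N' ≤ t ∧ (W.j t = k ∨ W.b t k ≠ 0)) →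
      (∀ t, N ≤ t → ((∀ y, (W.st t).r y + 1 ≤ s) ∧ ∃ x, (W.st t).r x = 0 ∧
        ∃ d ∈ (W.st t).F.support, ((d.degree : ℕ) : ℕ∞) = ordZero (W.st t).F ∧ (W.st t).r x < d x)) →
      (∀ M : ℕ, ∃ t, M ≤ t ∧ ∀ y, y ≠ W.j t → (W.st (t + 1)).r y = 0) → False) :
    NoLossyStrictTailsDeep := by
  intro p hp e he K _ _ _ _ s₀ hroot W hpos N hplat hne hS hb s hsN h3 h33 h22 hcoord hsd hlossy
  have hconst := shade_eq_of_plateau W hplat hsN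
  by_cases hlt : s < p ^ e
  · exact h p hp e he K s₀ hroot W hpos N hplat hne hS hb s hsN h3 h33 h22 hlt hcoord hsd hlossy
  · by_cases hgt : p ^ e < s
    · refine not_eventually_supercritical hroot W ⟨N, fun t ht => ?_⟩
      rw [hconst t ht]
      exact_mod_cast hgt
    · have hsq : s = p ^ e := by omega
      subst hsq
      exact critical_plateau_no_recurrent_stays hroot W N hconst hne hS

end Summit.ResolutionOfSingularities.ResolutionOfSingularities.Theorems.WallCutCritical
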